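import Literature.AlgebraicTopology.Homotopy.CubicalHomotopyAddition
import Literature.AlgebraicTopology.Homotopy.CubeHomotopyExtension
import HarnessLib

/-!
# Absolutising cubes whose boundary lies in a contractible subspace; the cubical homotopy
# addition theorem for cubes whose codimension-two skeleton lies in such a subspace

Topic `Literature/AlgebraicTopology/Homotopy`. Let `B ⊆ Y` be a subspace which contracts *inside
itself* to a point `y₀ ∈ B` keeping `y₀` fixed (`CubeAbs.PointedContraction`; the example this
file is written for is the space of paths of a pair `(X, A)` ending at the base point, with `B`
the paths running inside `A`, `RelativeLiddedCubes.lean`). Then a singular cube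
`v : (Iᴺ, ∂Iᴺ) → (Y, B)` has a well defined class in `π_N(Y, y₀)`:

* `CubeAbs.absHtpy`, `absLoop`, **`absClass c v hv ∈ π_N(Y, y₀)`** — deform `v|∂Iᴺ` to the
  constant map through `B` by the contraction and extend over `Iᴺ` by the homotopy extension
  property of `(Iᴺ, ∂Iᴺ)` (`CubeHEP.exists_extension_cube`, `CubeHomotopyExtension.lean`;
  Hatcher, *Algebraic Topology* (2002), Prop. 0.16); the end is a generalized loop at `y₀`;
* `CubeAbs.genLoop_homotopic_of_pairHomotopy` — two generalized loops at `y₀` which are homotopic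
  through maps `(Iᴺ, ∂Iᴺ) → (Y, B)` are homotopic rel `∂Iᴺ` (one application of the HEP of the
  cylinder `(I × Iᴺ, ∂(I × Iᴺ))`, `CubeHEP.exists_extension_cylinder`, to the contraction of the
  boundary track; Hatcher 2002, §4.1 p. 341, the mechanism of "`πₙ(X, A, x₀) → πₙ(X, x₀)` is an
  isomorphism when `A` is contractible", cf. Thm. 4.3 and Ex. 4.1.4); whence the class is
  independent of the extension chosen (`absClass_eq_mk`), invariant under homotopies of maps of
  pairs (`absClass_eq_of_pairHomotopy`) and trivial for cubes inside `B`
  (`absClass_eq_one_of_forall_mem`);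
* **`CubeAbs.prod_absClass_cubeFace_zpow_eq_one`** — for a cube `G : Iᴹ⁺³ → Y` mapping its
  codimension-two skeleton into `B` (`IsSkelIn B G`), the alternating product
  `∏ⱼ ([G ∘ ι_{j,1}] · [G ∘ ι_{j,0}]⁻¹)^((-1)ʲ)` of the classes of its faces vanishes in
  `π_{M+2}(Y, y₀)`: absolutise all faces compatibly (face by face over the common deformation of
  the codimension-two skeleton, then over the solid cube, by the HEP twice) and apply the cubical
  homotopy addition theorem `CubeHAT.prod_face_class_zpow_eq_one`
  (`CubicalHomotopyAddition.lean`; Hatcher 2002, §4.1 pp. 340–341).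

Everything is proved; `[folklore]` bookkeeping for the relative homotopy addition theorem
(Spanier, *Algebraic Topology* (1981), Ch. 7 §5 Prop. 3) in `Literature/AlgebraicTopology/SingularHomology/`.

## References

* A. Hatcher, *Algebraic Topology*, CUP (2002), Prop. 0.16; §4.1, pp. 340–344. [HatcherAT2002]
* E. H. Spanier, *Algebraic Topology*, Springer (1981), Ch. 7 §5, Prop. 3. [Spanier1981]
-/

noncomputable section

open scoped unitInterval Topology Topology.Homotopy
open Set Function

universe u

namespace Literature.AlgebraicTopology.Homotopy

namespace CubeAbs

open CubeHAT (cubeFace cubeFace_apply IsExtreme isExtreme_zero isExtreme_one IsSkelConst faceLoop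
  faceClass cls)

variable {Y : Type u} [TopologicalSpace Y] {B : Set Y} {y₀ : Y}

/-! ### Pointed contractions -/

variable (B y₀) in
/-- **A contraction of the subspace `B` inside itself to the point `y₀ ∈ B`, keeping `y₀` fixed**:
`c (0, b) = b`, `c (1, b) = y₀`, `c (s, y₀) = y₀`. [folklore] -/
structure PointedContraction where
  /-- the deformation `I × B → B` -/
  toFun : I × B → B
  /-- it is continuous -/
  continuous_toFun : Continuous toFun
  /-- the base point lies in `B` -/
  mem : y₀ ∈ B
  /-- it starts at the identity -/
  apply_zero : ∀ b : B, toFun (0, b) = b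
  /-- it ends at the base point -/
  apply_one : ∀ b : B, (toFun (1, b) : Y) = y₀
  /-- it fixes the base point -/
  apply_base : ∀ s : I, (toFun (s, ⟨y₀, mem⟩) : Y) = y₀

namespace PointedContraction

variable (c : PointedContraction B y₀)

/-- The deformation as a map into `Y`. [folklore] -/
def ev (s : I) (y : Y) (hy : y ∈ B) : Y := c.toFun (s, ⟨y, hy⟩)

/-- The deformation stays in `B`. [folklore] -/
lemma ev_mem (s : I) (y : Y) (hy : y ∈ B) : c.ev s y hy ∈ B := (c.toFun _).2

/-- The deformation starts at the identity. [folklore] -/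
@[simp] lemma ev_zero (y : Y) (hy : y ∈ B) : c.ev 0 y hy = y := by
  rw [ev, c.apply_zero]

/-- The deformation ends at the base point. [folklore] -/
@[simp] lemma ev_one (y : Y) (hy : y ∈ B) : c.ev 1 y hy = y₀ := c.apply_one _

/-- The deformation fixes the base point. [folklore] -/
lemma ev_base (s : I) (hy : y₀ ∈ B) : c.ev s y₀ hy = y₀ := c.apply_base s

/-- The deformation at equal points (proof-irrelevance helper). [folklore] -/
lemma ev_congr {s : I} {y y' : Y} (h : y = y') (hy : y ∈ B) (hy' : y' ∈ B) :
    c.ev s y hy = c.ev s y' hy' := by subst h; rfl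

/-- Joint continuity of the deformation along continuous data. [folklore] -/
lemma continuous_ev {Z : Type*} [TopologicalSpace Z] {s : Z → I} {f : Z → Y} (hs : Continuous s)
    (hf : Continuous f) (hfB : ∀ z, f z ∈ B) : Continuous fun z => c.ev (s z) (f z) (hfB z) :=
  continuous_subtype_val.comp (c.continuous_toFun.comp (hs.prodMk (hf.subtype_mk hfB)))

end PointedContraction

/-! ### Pair homotopies between generalized loops are homotopies rel `∂Iᴺ` -/

variable {N : Type*} [Fintype N]

/-- **Free-pair versus relative homotopy** (Hatcher 2002, §4.1 p. 341 ff.): if two generalized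
loops `w, w' : (Iᴺ, ∂Iᴺ) → (Y, y₀)` are joined by a homotopy `K` mapping `I × ∂Iᴺ` into a
subspace `B` with a pointed contraction to `y₀`, they are homotopic rel `∂Iᴺ`: contract the
boundary track of `K` through `B` (the ends, constant at `y₀`, stay put) and extend over the
cylinder by the HEP of `(I × Iᴺ, ∂(I × Iᴺ))`. [cite: HatcherAT2002, §4.1 p. 341] -/
theorem genLoop_homotopic_of_pairHomotopy (c : PointedContraction B y₀) (w w' : Ω^ N Y y₀)
    (K : C(I × (N → I), Y)) (hK0 : ∀ y, K (0, y) = w y) (hK1 : ∀ y, K (1, y) = w' y)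
    (hKB : ∀ (s : I), ∀ y ∈ Cube.boundary N, K (s, y) ∈ B) : GenLoop.Homotopic w w' := by
  classical
  -- the deformation of `K` on the boundary of the cylinder
  set Λ : I × (I × (N → I)) → Y := fun q =>
    if h : q.2.2 ∈ Cube.boundary N then c.ev q.1 (K q.2) (hKB q.2.1 q.2.2 h) else K q.2 with hΛ
  have hΛbd : ∀ (r s : I) (y : N → I) (hy : y ∈ Cube.boundary N),
      Λ (r, (s, y)) = c.ev r (K (s, y)) (hKB s y hy) := fun r s y hy => dif_pos hy
  have hΛ0 : ∀ (r : I) (y : N → I), Λ (r, (0, y)) = w y := by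
    intro r y
    by_cases hy : y ∈ Cube.boundary N
    · rw [hΛbd r 0 y hy, c.ev_congr ((hK0 y).trans (w.2 y hy)) _ c.mem, c.ev_base]
      exact (w.2 y hy).symm
    · show (if h : y ∈ Cube.boundary N then _ else _) = _
      rw [dif_neg hy, hK0]
  have hΛ1 : ∀ (r : I) (y : N → I), Λ (r, (1, y)) = w' y := by
    intro r y
    by_cases hy : y ∈ Cube.boundary N
    · rw [hΛbd r 1 y hy, c.ev_congr ((hK1 y).trans (w'.2 y hy)) _ c.mem, c.ev_base]
      exact (w'.2 y hy).symm
    · show (if h : y ∈ Cube.boundary N then _ else _) = _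
      rw [dif_neg hy, hK1]
  -- continuity on the boundary of the cylinder: three closed pieces
  have hc1 : ContinuousOn Λ (univ ×ˢ {p : I × (N → I) | p.2 ∈ Cube.boundary N}) := by
    rw [continuousOn_iff_continuous_restrict]
    have hcont : Continuous fun q : ↥((univ : Set I) ×ˢ {p : I × (N → I) | p.2 ∈ Cube.boundary N}) =>
        c.ev q.1.1 (K q.1.2) (hKB _ _ q.2.2) :=
      c.continuous_ev (by fun_prop) (by fun_prop) _
    refine hcont.congr fun q => ?_
    exact (hΛbd _ _ _ q.2.2).symm
  have hc2 : ContinuousOn Λ (univ ×ˢ {p : I × (N → I) | p.1 = 0}) := by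
    have : EqOn Λ (fun q => w q.2.2) (univ ×ˢ {p : I × (N → I) | p.1 = 0}) := by
      rintro ⟨r, s, y⟩ ⟨-, hs⟩
      simp only [mem_setOf_eq] at hs
      subst hs
      exact hΛ0 r y
    exact (Continuous.continuousOn (by fun_prop)).congr this
  have hc3 : ContinuousOn Λ (univ ×ˢ {p : I × (N → I) | p.1 = 1}) := by
    have : EqOn Λ (fun q => w' q.2.2) (univ ×ˢ {p : I × (N → I) | p.1 = 1}) := by
      rintro ⟨r, s, y⟩ ⟨-, hs⟩
      simp only [mem_setOf_eq] at hs
      subst hs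
      exact hΛ1 r y
    exact (Continuous.continuousOn (by fun_prop)).congr this
  have hcl1 : IsClosed ((univ : Set I) ×ˢ {p : I × (N → I) | p.2 ∈ Cube.boundary N}) :=
    isClosed_univ.prod (CubeHEP.isClosed_cubeBoundary.preimage continuous_snd)
  have hcl2 : IsClosed ((univ : Set I) ×ˢ {p : I × (N → I) | p.1 = 0}) :=
    isClosed_univ.prod (isClosed_eq continuous_fst continuous_const)
  have hcl3 : IsClosed ((univ : Set I) ×ˢ {p : I × (N → I) | p.1 = 1}) :=
    isClosed_univ.prod (isClosed_eq continuous_fst continuous_const)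
  have hΛc : ContinuousOn Λ (univ ×ˢ GenLoopPath.cylBd N) := by
    have hU : (univ : Set I) ×ˢ GenLoopPath.cylBd N =
        (univ ×ˢ {p : I × (N → I) | p.1 = 0} ∪ univ ×ˢ {p : I × (N → I) | p.1 = 1}) ∪
          univ ×ˢ {p : I × (N → I) | p.2 ∈ Cube.boundary N} := by
      ext ⟨r, s, y⟩
      simp only [GenLoopPath.cylBd, mem_prod, mem_univ, true_and, mem_setOf_eq, mem_union, or_assoc]
    rw [hU]
    exact ((hc2.union_of_isClosed hc3 hcl2 hcl3).union_of_isClosed hc1 (hcl2.union hcl3) hcl1)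
  have h0 : ∀ p ∈ GenLoopPath.cylBd N, Λ (0, p) = K p := by
    rintro ⟨s, y⟩ hp
    by_cases hy : y ∈ Cube.boundary N
    · rw [hΛbd 0 s y hy, c.ev_zero]
    · show (if h : y ∈ Cube.boundary N then _ else _) = _
      rw [dif_neg hy]
  obtain ⟨Φ, -, hΦbd⟩ := CubeHEP.exists_extension_cylinder K Λ hΛc h0
  refine ⟨{ toFun := fun p => Φ (1, p)
            continuous_toFun := by fun_prop
            map_zero_left := fun y => by
              show Φ (1, (0, y)) = _
              rw [hΦbd 1 (0, y) (Or.inl rfl), hΛ0]; rfl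
            map_one_left := fun y => by
              show Φ (1, (1, y)) = _
              rw [hΦbd 1 (1, y) (Or.inr (Or.inl rfl)), hΛ1]; rfl
            prop' := fun s y hy => by
              show Φ (1, (s, y)) = _
              rw [hΦbd 1 (s, y) (Or.inr (Or.inr hy)), hΛbd 1 s y hy, c.ev_one]
              exact (w.2 y hy).symm }⟩

/-! ### The absolutisation of a cube with boundary in `B` -/

/-- A cube `v : Iᴺ → Y` with `v(∂Iᴺ) ⊆ B` admits a homotopy which on `∂Iᴺ` is the contraction of
`v` through `B` to `y₀` (HEP of `(Iᴺ, ∂Iᴺ)`, Hatcher 2002, Prop. 0.16). [cite: HatcherAT2002, Prop. 0.16] -/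
theorem exists_absHtpy (c : PointedContraction B y₀) (v : C(N → I, Y))
    (hv : ∀ y ∈ Cube.boundary N, v y ∈ B) :
    ∃ H : C(I × (N → I), Y), (∀ y, H (0, y) = v y) ∧
      ∀ (s : I), ∀ (y) (hy : y ∈ Cube.boundary N), H (s, y) = c.ev s (v y) (hv y hy) := by
  classical
  set h : I × (N → I) → Y := fun q =>
    if hq : q.2 ∈ Cube.boundary N then c.ev q.1 (v q.2) (hv q.2 hq) else y₀ with hh
  have hbd : ∀ (s : I) (y : N → I) (hy : y ∈ Cube.boundary N),
      h (s, y) = c.ev s (v y) (hv y hy) := fun s y hy => dif_pos hy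
  have hcont : ContinuousOn h (univ ×ˢ Cube.boundary N) := by
    rw [continuousOn_iff_continuous_restrict]
    have hcont : Continuous fun q : ↥((univ : Set I) ×ˢ Cube.boundary N) =>
        c.ev q.1.1 (v q.1.2) (hv _ q.2.2) :=
      c.continuous_ev (by fun_prop) (by fun_prop) _
    refine hcont.congr fun q => ?_
    exact (hbd _ _ q.2.2).symm
  have h0 : ∀ y ∈ Cube.boundary N, h (0, y) = v y := fun y hy => by
    rw [hbd 0 y hy, c.ev_zero]
  obtain ⟨H, hH0, hHbd⟩ := CubeHEP.exists_extension_cube v h hcont h0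
  refine ⟨H, hH0, fun s y hy => ?_⟩
  rw [hHbd s y hy, hbd s y hy]

/-- **The absolutising homotopy** of a cube `v : (Iᴺ, ∂Iᴺ) → (Y, B)` (a choice). [folklore] -/
def absHtpy (c : PointedContraction B y₀) (v : C(N → I, Y)) (hv : ∀ y ∈ Cube.boundary N, v y ∈ B) :
    C(I × (N → I), Y) :=
  Classical.choose (exists_absHtpy c v hv)

/-- The absolutising homotopy starts at `v`. [folklore] -/
lemma absHtpy_zero (c : PointedContraction B y₀) (v : C(N → I, Y))
    (hv : ∀ y ∈ Cube.boundary N, v y ∈ B) (y : N → I) : absHtpy c v hv (0, y) = v y :=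
  (Classical.choose_spec (exists_absHtpy c v hv)).1 y

/-- On `∂Iᴺ` the absolutising homotopy is the contraction of `v`. [folklore] -/
lemma absHtpy_of_mem (c : PointedContraction B y₀) (v : C(N → I, Y))
    (hv : ∀ y ∈ Cube.boundary N, v y ∈ B) (s : I) (y : N → I) (hy : y ∈ Cube.boundary N) :
    absHtpy c v hv (s, y) = c.ev s (v y) (hv y hy) :=
  (Classical.choose_spec (exists_absHtpy c v hv)).2 s y hy

/-- On `∂Iᴺ` the absolutising homotopy stays in `B`. [folklore] -/
lemma absHtpy_mem (c : PointedContraction B y₀) (v : C(N → I, Y))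
    (hv : ∀ y ∈ Cube.boundary N, v y ∈ B) (s : I) (y : N → I) (hy : y ∈ Cube.boundary N) :
    absHtpy c v hv (s, y) ∈ B := by
  rw [absHtpy_of_mem c v hv s y hy]; exact c.ev_mem _ _ _

/-- On `∂Iᴺ` the absolutising homotopy ends at `y₀`. [folklore] -/
lemma absHtpy_one_of_mem (c : PointedContraction B y₀) (v : C(N → I, Y))
    (hv : ∀ y ∈ Cube.boundary N, v y ∈ B) (y : N → I) (hy : y ∈ Cube.boundary N) :
    absHtpy c v hv (1, y) = y₀ := by
  rw [absHtpy_of_mem c v hv 1 y hy, c.ev_one]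

/-- **The absolutised cube**: the end of the absolutising homotopy, a generalized loop at `y₀`.
[folklore] -/
def absLoop (c : PointedContraction B y₀) (v : C(N → I, Y)) (hv : ∀ y ∈ Cube.boundary N, v y ∈ B) :
    Ω^ N Y y₀ :=
  ⟨(absHtpy c v hv).curry 1, fun y hy => absHtpy_one_of_mem c v hv y hy⟩

/-- `absLoop` pointwise. [folklore] -/
@[simp] lemma absLoop_apply (c : PointedContraction B y₀) (v : C(N → I, Y))
    (hv : ∀ y ∈ Cube.boundary N, v y ∈ B) (y : N → I) : absLoop c v hv y = absHtpy c v hv (1, y) :=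
  rfl

/-- **The class `[v] ∈ π_N(Y, y₀)` of a cube `v : (Iᴺ, ∂Iᴺ) → (Y, B)`**, `B` contracting in itself
to `y₀` (Hatcher 2002, §4.1: `πₙ(X, A, x₀) ≅ πₙ(X, x₀)` for contractible `A`, made explicit on
representatives). [cite: HatcherAT2002, §4.1 p. 344] -/
def absClass (c : PointedContraction B y₀) (v : C(N → I, Y)) (hv : ∀ y ∈ Cube.boundary N, v y ∈ B) :
    HomotopyGroup N Y y₀ :=
  ⟦absLoop c v hv⟧

/-- **Independence of the extension**: any generalized loop at `y₀` homotopic to `v` through maps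
of pairs `(Iᴺ, ∂Iᴺ) → (Y, B)` represents `absClass c v`. [folklore] -/
theorem absClass_eq_mk (c : PointedContraction B y₀) {v : C(N → I, Y)}
    (hv : ∀ y ∈ Cube.boundary N, v y ∈ B) (w : Ω^ N Y y₀) (K : C(I × (N → I), Y))
    (hK0 : ∀ y, K (0, y) = v y) (hK1 : ∀ y, K (1, y) = w y)
    (hKB : ∀ (s : I), ∀ y ∈ Cube.boundary N, K (s, y) ∈ B) : absClass c v hv = ⟦w⟧ := by
  let Hv : ContinuousMap.Homotopy v (absLoop c v hv).1 :=
    { toContinuousMap := absHtpy c v hv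
      map_zero_left := absHtpy_zero c v hv
      map_one_left := fun _ => rfl }
  let HK : ContinuousMap.Homotopy v (w : C(N → I, Y)) :=
    { toContinuousMap := K, map_zero_left := hK0, map_one_left := hK1 }
  let F := Hv.symm.trans HK
  refine Quotient.sound (genLoop_homotopic_of_pairHomotopy c (absLoop c v hv) w F.toContinuousMap
    (fun y => F.apply_zero y) (fun y => F.apply_one y) fun s y hy => ?_)
  show (Hv.symm.trans HK) (s, y) ∈ B
  rw [ContinuousMap.Homotopy.trans_apply]
  split_ifs with h
  · exact absHtpy_mem c v hv _ y hy
  · exact hKB _ y hy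

/-- The class of a generalized loop at `y₀` is its own class. [folklore] -/
theorem absClass_genLoop (c : PointedContraction B y₀) (w : Ω^ N Y y₀)
    (hv : ∀ y ∈ Cube.boundary N, (w : C(N → I, Y)) y ∈ B) : absClass c w.1 hv = ⟦w⟧ :=
  absClass_eq_mk c hv w ((ContinuousMap.Homotopy.refl w.1).toContinuousMap) (fun _ => rfl)
    (fun _ => rfl) fun _ y hy => hv y hy

/-- **Invariance under homotopies of maps of pairs** `(Iᴺ, ∂Iᴺ) → (Y, B)`. [folklore] -/
theorem absClass_eq_of_pairHomotopy (c : PointedContraction B y₀) {v v' : C(N → I, Y)}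
    (hv : ∀ y ∈ Cube.boundary N, v y ∈ B) (hv' : ∀ y ∈ Cube.boundary N, v' y ∈ B)
    (K : C(I × (N → I), Y)) (hK0 : ∀ y, K (0, y) = v y) (hK1 : ∀ y, K (1, y) = v' y)
    (hKB : ∀ (s : I), ∀ y ∈ Cube.boundary N, K (s, y) ∈ B) :
    absClass c v hv = absClass c v' hv' := by
  -- `v ≃ v' ≃ absLoop v'` through maps of pairs
  let HK : ContinuousMap.Homotopy v v' :=
    { toContinuousMap := K, map_zero_left := hK0, map_one_left := hK1 }
  let Hv' : ContinuousMap.Homotopy v' (absLoop c v' hv').1 :=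
    { toContinuousMap := absHtpy c v' hv'
      map_zero_left := absHtpy_zero c v' hv'
      map_one_left := fun _ => rfl }
  let F := HK.trans Hv'
  refine absClass_eq_mk c hv (absLoop c v' hv') F.toContinuousMap (fun y => F.apply_zero y)
    (fun y => F.apply_one y) fun s y hy => ?_
  show (HK.trans Hv') (s, y) ∈ B
  rw [ContinuousMap.Homotopy.trans_apply]
  split_ifs with h
  · exact hKB _ y hy
  · exact absHtpy_mem c v' hv' _ y hy

/-- Cubes with pointwise equal values have the same class. [folklore] -/
theorem absClass_congr (c : PointedContraction B y₀) {v v' : C(N → I, Y)}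
    (hv : ∀ y ∈ Cube.boundary N, v y ∈ B) (hv' : ∀ y ∈ Cube.boundary N, v' y ∈ B)
    (h : ∀ y, v y = v' y) : absClass c v hv = absClass c v' hv' :=
  absClass_eq_of_pairHomotopy c hv hv' ⟨fun q => v q.2, by fun_prop⟩ (fun _ => rfl) (fun y => h y)
    fun _ y hy => hv y hy

/-- **A cube inside `B` has trivial class** (it contracts to the constant cube through maps of
pairs). [folklore] -/
theorem absClass_eq_one_of_forall_mem [DecidableEq N] [Nonempty N] (c : PointedContraction B y₀) {v : C(N → I, Y)}
    (hvB : ∀ y, v y ∈ B) :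
    absClass c v (fun y _ => hvB y) = 1 := by
  rw [HomotopyGroup.one_def, ← absClass_genLoop c GenLoop.const (fun _ _ => c.mem)]
  refine absClass_eq_of_pairHomotopy c _ _
    ⟨fun q => c.ev q.1 (v q.2) (hvB q.2), c.continuous_ev continuous_fst (by fun_prop) _⟩
    (fun y => c.ev_zero _ _) (fun y => c.ev_one _ _) fun s y _ => c.ev_mem _ _ _

/-! ### Cubes whose codimension-two skeleton lies in `B` -/

variable (B) in
/-- `G : Iᴺ⁺¹ → Y` maps the codimension-two skeleton of the cube (points with two distinct extreme
coordinates) into `B`; the relative form of `CubeHAT.IsSkelConst`. [folklore] -/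
def IsSkelIn {n : ℕ} (G : C(Fin (n + 1) → I, Y)) : Prop :=
  ∀ (y : Fin (n + 1) → I) (i j : Fin (n + 1)), i ≠ j → IsExtreme (y i) → IsExtreme (y j) → G y ∈ B

/-- Under `IsSkelIn`, every face `{y_j = ε}`, `ε = 0, 1`, maps `∂Iᴺ` into `B`. [folklore] -/
lemma IsSkelIn.cubeFace_mem {n : ℕ} {G : C(Fin (n + 1) → I, Y)} (hG : IsSkelIn B G)
    (j : Fin (n + 1)) {ε : I} (hε : IsExtreme ε) :
    ∀ t ∈ Cube.boundary (Fin n), cubeFace G j ε t ∈ B := by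
  rintro t ⟨i, hi⟩
  rw [cubeFace_apply]
  refine hG _ j (j.succAbove i) (Fin.ne_succAbove j i) ?_ ?_
  · rw [Fin.insertNth_apply_same]; exact hε
  · rw [Fin.insertNth_apply_succAbove]; exact hi

/-- A point of a face `{y_j = ε}` with a second extreme coordinate has its remaining coordinates on
`∂Iᴺ`. [folklore] -/
lemma removeNth_mem_boundary {n : ℕ} {y : Fin (n + 1) → I} {i j : Fin (n + 1)} (hij : i ≠ j)
    (hi : IsExtreme (y i)) : Fin.removeNth j y ∈ Cube.boundary (Fin n) := by
  obtain ⟨i', rfl⟩ := Fin.exists_succAbove_eq hij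
  exact ⟨i', hi⟩

section SkelHAT

variable {M : ℕ} (c : PointedContraction B y₀) (G : C(Fin (M + 3) → I, Y)) (hG : IsSkelIn B G)

/-- The deformation of `G` on `∂Iᴹ⁺³`: on the codimension-two skeleton the contraction of `G`
through `B`, on each face the absolutising homotopy of that face (these agree where they overlap).
[folklore] -/
def bdHtpy (q : I × (Fin (M + 3) → I)) : Y := by
  classical
  exact if h2 : ∃ i j : Fin (M + 3), i ≠ j ∧ IsExtreme (q.2 i) ∧ IsExtreme (q.2 j) then
      c.ev q.1 (G q.2) (hG q.2 _ _ h2.choose_spec.choose_spec.1 h2.choose_spec.choose_spec.2.1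
        h2.choose_spec.choose_spec.2.2)
    else if h1 : ∃ j : Fin (M + 3), IsExtreme (q.2 j) then
      absHtpy c (cubeFace G h1.choose (q.2 h1.choose)) (hG.cubeFace_mem h1.choose h1.choose_spec)
        (q.1, Fin.removeNth h1.choose q.2)
    else G q.2

include hG in
/-- On the face `{y_j = ε}` the boundary deformation is the absolutising homotopy of that face.
[folklore] -/
lemma bdHtpy_eq (s : I) {j : Fin (M + 3)} {ε : I} (hε : IsExtreme ε) (y : Fin (M + 3) → I)
    (hy : y j = ε) :
    bdHtpy c G hG (s, y) = absHtpy c (cubeFace G j ε) (hG.cubeFace_mem j hε) (s, Fin.removeNth j y) := by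
  classical
  have hyj : IsExtreme (y j) := hy ▸ hε
  unfold bdHtpy
  split_ifs with h2 h1
  · -- two extreme coordinates: both sides are the contraction of `G y`
    obtain ⟨i, i', hii', hi, hi'⟩ := h2
    have hb : Fin.removeNth j y ∈ Cube.boundary (Fin (M + 2)) := by
      by_cases hij : i = j
      · subst hij; exact removeNth_mem_boundary hii'.symm hi'
      · exact removeNth_mem_boundary hij hi
    rw [absHtpy_of_mem c _ _ s _ hb]
    exact c.ev_congr (by rw [cubeFace_apply, ← hy, Fin.insertNth_self_removeNth]) _ _
  · -- exactly one extreme coordinate, namely `j`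
    have hj : h1.choose = j := by
      by_contra hne
      exact h2 ⟨h1.choose, j, hne, h1.choose_spec, hyj⟩
    -- transport along `hj` and `hy`
    have key : ∀ (j' : Fin (M + 3)) (hj' : j' = j) (h' : IsExtreme (y j')),
        absHtpy c (cubeFace G j' (y j')) (hG.cubeFace_mem j' h') (s, Fin.removeNth j' y) =
          absHtpy c (cubeFace G j ε) (hG.cubeFace_mem j hε) (s, Fin.removeNth j y) := by
      intro j' hj' h'
      subst hj'
      subst hy
      rfl
    exact key _ hj h1.choose_spec
  · exact absurd ⟨j, hyj⟩ h1

include hG in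
/-- The boundary deformation is continuous on `I × ∂Iᴹ⁺³`. [folklore] -/
lemma continuousOn_bdHtpy : ContinuousOn (bdHtpy c G hG) (univ ×ˢ Cube.boundary (Fin (M + 3))) := by
  -- `∂Iᴹ⁺³` as the finite union of the closed faces `{y_j = ε}`
  set F : Fin (M + 3) × Bool → Set (I × (Fin (M + 3) → I)) := fun p =>
    univ ×ˢ {y | y p.1 = if p.2 then 1 else 0} with hF
  have hU : (univ : Set I) ×ˢ Cube.boundary (Fin (M + 3)) = ⋃ p, F p := by
    ext ⟨s, y⟩
    simp only [mem_prod, mem_univ, true_and, mem_iUnion, hF, mem_setOf_eq, Prod.exists,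
      Bool.exists_bool, Bool.false_eq_true, ↓reduceIte]
    constructor
    · rintro ⟨j, hj | hj⟩
      · exact ⟨j, Or.inl hj⟩
      · exact ⟨j, Or.inr hj⟩
    · rintro ⟨j, hj | hj⟩
      · exact ⟨j, Or.inl hj⟩
      · exact ⟨j, Or.inr hj⟩
  rw [hU]
  refine LocallyFinite.continuousOn_iUnion (locallyFinite_of_finite F) (fun p => ?_) fun p => ?_
  · exact isClosed_univ.prod (isClosed_eq (continuous_apply p.1) continuous_const)
  · obtain ⟨j, b⟩ := p
    have hε : IsExtreme (if b then (1 : I) else 0) := by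
      cases b
      · exact isExtreme_zero
      · exact isExtreme_one
    have hcont : Continuous fun q : I × (Fin (M + 3) → I) =>
        absHtpy c (cubeFace G j (if b then 1 else 0)) (hG.cubeFace_mem j hε)
          (q.1, Fin.removeNth j q.2) := by
      refine (absHtpy c _ _).continuous.comp (continuous_fst.prodMk ?_)
      exact continuous_pi fun i => (continuous_apply _).comp continuous_snd
    refine hcont.continuousOn.congr ?_
    rintro ⟨s, y⟩ ⟨-, hy⟩
    exact bdHtpy_eq c G hG s hε y hy

include hG in
/-- The boundary deformation starts at `G`. [folklore] -/
lemma bdHtpy_zero (y : Fin (M + 3) → I) (hy : y ∈ Cube.boundary (Fin (M + 3))) :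
    bdHtpy c G hG (0, y) = G y := by
  obtain ⟨j, hj | hj⟩ := hy
  · rw [bdHtpy_eq c G hG 0 isExtreme_zero y hj, absHtpy_zero, cubeFace_apply, ← hj,
      Fin.insertNth_self_removeNth]
  · rw [bdHtpy_eq c G hG 0 isExtreme_one y hj, absHtpy_zero, cubeFace_apply, ← hj,
      Fin.insertNth_self_removeNth]

/-- **The absolutised cube**: the end of an extension over `Iᴹ⁺³` of the boundary deformation
(HEP of `(Iᴹ⁺³, ∂Iᴹ⁺³)`; a choice). [folklore] -/
def absCube : C(Fin (M + 3) → I, Y) :=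
  (Classical.choose (CubeHEP.exists_extension_cube G (bdHtpy c G hG) (continuousOn_bdHtpy c G hG)
    (bdHtpy_zero c G hG))).curry 1

include hG in
/-- On `∂Iᴹ⁺³` the absolutised cube is the end of the boundary deformation. [folklore] -/
lemma absCube_apply_of_mem (y : Fin (M + 3) → I) (hy : y ∈ Cube.boundary (Fin (M + 3))) :
    absCube c G hG y = bdHtpy c G hG (1, y) :=
  (Classical.choose_spec (CubeHEP.exists_extension_cube G (bdHtpy c G hG)
    (continuousOn_bdHtpy c G hG) (bdHtpy_zero c G hG))).2 1 y hy

include hG in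
/-- The absolutised cube is constant `= y₀` on the codimension-two skeleton. [folklore] -/
lemma isSkelConst_absCube : IsSkelConst y₀ (absCube c G hG) := by
  intro y i j hij hi hj
  have hyb : y ∈ Cube.boundary (Fin (M + 3)) := ⟨i, hi⟩
  rcases hj with hj | hj
  · rw [absCube_apply_of_mem c G hG y hyb, bdHtpy_eq c G hG 1 isExtreme_zero y hj,
      absHtpy_one_of_mem]
    exact removeNth_mem_boundary hij hi
  · rw [absCube_apply_of_mem c G hG y hyb, bdHtpy_eq c G hG 1 isExtreme_one y hj,
      absHtpy_one_of_mem]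
    exact removeNth_mem_boundary hij hi

include hG in
/-- The faces of the absolutised cube are the absolutised faces. [folklore] -/
lemma faceClass_absCube (j : Fin (M + 3)) {ε : I} (hε : IsExtreme ε) :
    faceClass (absCube c G hG) (isSkelConst_absCube c G hG) j ε hε =
      absClass c (cubeFace G j ε) (hG.cubeFace_mem j hε) := by
  refine congrArg cls (CubeHAT.genLoop_eq_of_forall fun t => ?_)
  rw [CubeHAT.faceLoop_apply, absLoop_apply,
    absCube_apply_of_mem c G hG _ ⟨j, by rw [Fin.insertNth_apply_same]; exact hε⟩,
    bdHtpy_eq c G hG 1 (j := j) hε _ (by simp), Fin.removeNth_insertNth]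

include hG in
/-- **The cubical homotopy addition theorem for a cube whose codimension-two skeleton lies in a
subspace contracting in itself to the base point**: the alternating product of the classes of its
faces vanishes in `π_{M+2}(Y, y₀)` (Hatcher 2002, §4.1 pp. 340–341, through
`CubeHAT.prod_face_class_zpow_eq_one` applied to the absolutised cube). [cite: HatcherAT2002, §4.1 pp. 340–341] -/
theorem prod_absClass_cubeFace_zpow_eq_one :
    ∏ j : Fin (M + 3), (absClass c (cubeFace G j 1) (hG.cubeFace_mem j isExtreme_one) *
        (absClass c (cubeFace G j 0) (hG.cubeFace_mem j isExtreme_zero))⁻¹) ^ ((-1 : ℤ) ^ (j : ℕ)) =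
      1 := by
  rw [← CubeHAT.prod_face_class_zpow_eq_one (absCube c G hG) (isSkelConst_absCube c G hG)]
  refine Finset.prod_congr rfl fun j _ => ?_
  rw [faceClass_absCube c G hG j isExtreme_one, faceClass_absCube c G hG j isExtreme_zero]

end SkelHAT

end CubeAbs

end Literature.AlgebraicTopology.Homotopy

end
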